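import Summits.SmoothPoincare4.SmoothPoincare4.Theses.EntropyRung
import Summits.SmoothPoincare4.SmoothPoincare4.Theorems.SubcylindricalExistence.Negative.Window
import Summits.SmoothPoincare4.SmoothPoincare4.Theorems.SubcylindricalExistence.Negative.Logic
import Summits.SmoothPoincare4.SmoothPoincare4.Theorems.EntropyRungSubcylindricalExistenceSchwarzschildReduction
import Summits.SmoothPoincare4.SmoothPoincare4.Theorems.EntropyRungSubcylindricalExistenceSphereWitness
import Summits.SmoothPoincare4.SmoothPoincare4.Theorems.SubcylindricalExistence.Negative.SchwarzschildBlowupExistence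
import Summits.SmoothPoincare4.SmoothPoincare4.Theorems.EntropyRungSubcylindricalExistenceRoundClauseEuclidean
import Literature.Geometry.Riemannian.RoundSphereProofs
import Literature.Geometry.Riemannian.AubinYamabeSphereEuclidean
import Mathlib.Analysis.Calculus.Gradient.Basic
import HarnessLib
import HarnessLib.Audit

/-!
# Line `green-blowup-conformal-entropy` for the crux `EntropyRung.SubcylindricalExistence`
(stmt-SmoothPoincare4-10871) — lead c5 skeleton (continuation of lead c3's reshape R-c3)

ENT := every closed smooth homotopy 4-sphere `M` carries a Riemannian metric with `R > 0` and
`ν(g) > ν_cyl = log 2 + ½ log π − 3/2`.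

STATE OF THE LINE. Reshape R-c3 (Schwarzschild gauge, lead c3) is BUILT: the crux follows from the single
transfer stub Â_b `stub_schwarzschildBlowupExistence` by the landed reduction
`Theorems.subcylindricalExistence_of_schwarzschildBlowupExistence` (p127092, composing the landed S3', S5',
Cut', E2, S2'M, D', C, E). `SubcylindricalExistence_of` below is that one-line composition; the only
`sorry` on the crux path is Â_b (SPC4-hard given the rung: `not_schwarzschildBlowupExistence_of_not_spc4`,
proved below by pure logic, is the registered negative export).

CYCLE 1 OF LEAD c5 (= lead c3's announced, never executed cycle 2) — DONE: the `S⁴` WITNESS of Â_b,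
`helper_schwarzschildBlowupExistence_sphereFour` — Â_b's body for Mathlib's `S⁴ ⊂ ℝ⁵` — LANDED
(`Theorems/EntropyRungSubcylindricalExistenceSphereWitness.lean`, p135257) from the nine witness helpers
registered by c3, ALL NINE LANDED in waves 1–2 of lead c5 (p134137, p134220, p134173, p134378, p134301,
p134214, p134190, p134610, p135050), and the negative export LANDED (p135162):
* `helper_sphereChart` — Mathlib's stereographic chart at `p`: `φ p = 0`, target `univ`, source `{-p}ᶜ`,
  `⟪φ⁻¹ y, p⟫ = (4 − ‖y‖²)/(4 + ‖y‖²)`;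
* `helper_sphereHeight` — the height function `x ↦ ⟪x, p⟫` on the round `S⁴`: smooth, `|∇h|² = 1 − h²`,
  `□h = −4h`;
* `helper_concaveRamp` — a smooth concave ramp `θ` (identity below `s₁`, constant above `s₂`);
* `helper_euclideanClauseOfRound` — the Euclidean `𝒲`-clause at level `log 6 − 2` for `C_c^∞(ℝ⁴)`
  (RoundBound `stub_roundClauseEuclidean`, radius → ∞);
* `helper_sphereGreenRound` — `G_S = 2/(1 − ⟪x,p⟫)` solves `12·G − 6□G = 0` off `p` (round Green function
  of the conformal Laplacian), with `|∇G_S|² = G_S²(G_S − 1)`;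
* `helper_sphereWarpedFactor` — `W = θ(2/(1 + ⟪x,p⟫))` is smooth positive with `12W − 6□W ≥ 0`, `= 0`
  exactly on `{2/(1+⟪x,p⟫) ≤ s₁}`;
* `helper_sphereWarpedRealisation` — `g = W² g_S` realised with Levi-Civita connection,
  `R_g = W⁻³(12W − 6□W) ≥ 0` vanishing only on the chart ball `‖y‖ ≤ r` (`s₁ = 1 + r²/4`), and `g`
  EUCLIDEAN there in the atlas chart at `p`;
* `helper_sphereGreenWarped` — `G = G_S/W` is the Green function of `L_g` (conformal covariance),
  `G(φ⁻¹y) = 4/‖y‖²` on the ball (`a = 4`, `b = 0`);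
* `helper_sphereBlowupTransport` — `G²g = δ` exactly in the chart at `−p`, so the blow-up clause on `S⁴`
  at level `L` follows from the Euclidean clause at level `L`.
Then `δ := (log 6 − 2) − ν_cyl > 0` (`Negative.nuCyl_lt_nuRound`).

Disproof used: the item's evidence notes (cdisprove Disproof v1–v6; the file itself is not mounted in this
jail) and the landed `Negative/{Logic, Window, ConstTest, BlowupExistence}`: no `_false_without_` theorem is
published for this crux; `BlowupExistence.spc4_of_blowupExistence` (PMT rigidity of the exact gauge `b = 0`
REQUIRED) is why Â_b allows `b ≥ 0`; the witness uses `b = 0`, which Â_b permits.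
-/

noncomputable section

open scoped Manifold ContDiff Topology ENNReal NNReal ContinuousMap RealInnerProductSpace
open Set Filter MeasureTheory
open Literature.Geometry.Lorentzian Literature.Geometry.Riemannian
set_option linter.dupNamespace false

namespace Summit.SmoothPoincare4.SmoothPoincare4.Cruxes.SubcylindricalExistence.GreenBlowupConformalEntropy

open Summit.SmoothPoincare4.SmoothPoincare4.Theses.EntropyRung

/-- **Stub Â_b — the transfer stub (HARDEST; SPC4-hard given the rung; open by design).** Every closed smooth homotopy 4-sphere carries Green data `(g, p, G)` in the Schwarzschild gauge (`g` Euclidean in the atlas chart at `p` on `‖y − φp‖ ≤ r`, `G(φ⁻¹y) = a/‖y − φp‖² + b` there, `R_g ≥ 0` vanishing only on that ball) whose blow-up clears `ν_cyl + δ`. TRUE on `S⁴` (`helper_schwarzschildBlowupExistence_sphereFour`, `b = 0`). [folklore] -/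
theorem stub_schwarzschildBlowupExistence :
    ∀ (M : Type) [TopologicalSpace M] [T2Space M] [SecondCountableTopology M] [ChartedSpace
      (EuclideanSpace ℝ (Fin 4)) M] [IsManifold (𝓡 4) ∞ M] [CompactSpace M] [T3Space M]
      [MeasurableSpace M] [BorelSpace M], M ≃ₕ Metric.sphere (0 : EuclideanSpace ℝ (Fin 5)) 1 → ∃ g
      : PseudoRiemannianMetric (𝓡 4) ∞ (EuclideanSpace ℝ (Fin 4)) (TangentSpace (𝓡 4) : M → Type _),
      ∃ _ : g.HasLeviCivita, ∃ hg : g.IsRiemannian, ∃ p : M, ∃ G : M → ℝ, ∃ a b r : ℝ, (ContMDiffOn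
      (𝓡 4) 𝓘(ℝ, ℝ) ∞ G {p}ᶜ ∧ (∀ x, x ≠ p → 0 < G x) ∧ (∀ x, x ≠ p → g.scalarCurvature x * G x - 6
      * g.dalembertian G x = 0) ∧ Tendsto G (𝓝[≠] p) atTop) ∧ (∀ x, 0 ≤ g.scalarCurvature x) ∧ (∀ x,
      g.scalarCurvature x = 0 → x ∈ (extChartAt (𝓡 4) p).source ∧ extChartAt (𝓡 4) p x ∈
      Metric.closedBall (extChartAt (𝓡 4) p p) r) ∧ 0 < a ∧ 0 ≤ b ∧ 0 < r ∧ (Metric.closedBall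
      (extChartAt (𝓡 4) p p) r ⊆ (extChartAt (𝓡 4) p).target ∧ ∀ y ∈ Metric.closedBall (extChartAt
      (𝓡 4) p p) r, ∀ X W : EuclideanSpace ℝ (Fin 4), g.val ((extChartAt (𝓡 4) p).symm y) (mfderiv
      𝓘(ℝ, EuclideanSpace ℝ (Fin 4)) (𝓡 4) (extChartAt (𝓡 4) p).symm y X) (mfderiv 𝓘(ℝ,
      EuclideanSpace ℝ (Fin 4)) (𝓡 4) (extChartAt (𝓡 4) p).symm y W) = ⟪X, W⟫) ∧ (∀ y ∈
      Metric.closedBall (extChartAt (𝓡 4) p p) r, y ≠ extChartAt (𝓡 4) p p → G ((extChartAt (𝓡 4)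
      p).symm y) = a / ‖y - extChartAt (𝓡 4) p p‖ ^ 2 + b) ∧ ∃ δ : ℝ, 0 < δ ∧ ∀ τ : ℝ, 0 < τ → ∀ w :
      M → ℝ, ContMDiff (𝓡 4) 𝓘(ℝ, ℝ) ∞ w → w =ᶠ[𝓝 p] 0 → ∫ x, (4 * Real.pi * τ) ^ (-(4 : ℝ) / 2) *
      (w x) ^ 2 * (G x) ^ 4 ∂(riemannianMeasure (g.toContMDiffRiemannianMetric hg)) = 1 → Real.log 2
      + Real.log Real.pi / 2 - 3 / 2 + δ ≤ ∫ x, (4 * τ * ((G x)⁻¹ ^ 2 * g.gradSq w x) - (w x) ^ 2 *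
      Real.log ((w x) ^ 2) - 4 * (w x) ^ 2) * ((4 * Real.pi * τ) ^ (-(4 : ℝ) / 2) * (G x) ^ 4)
      ∂(riemannianMeasure (g.toContMDiffRiemannianMetric hg)) := by
  sorry

/-- **The `S⁴` witness of the transfer stub Â_b** (`b = 0`, `a = 4`, `r = 2`): on Mathlib's unit sphere
`S⁴ ⊂ ℝ⁵` take `g = W² g_S` with `W = θ(2/(1 + ⟪x, p⟫))` (`θ` the concave ramp with `s₁ = 1 + 2²/4`,
`s₂ = 3`), Green function `G = (2/(1 − ⟪x, p⟫))/W`; `g` is Euclidean on the chart ball `‖y‖ ≤ 2` at `p`,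
`G = 4/‖y‖²` there, `R_g ≥ 0` vanishes only there, and the blow-up `G² g` is flat `ℝ⁴`, whose `𝒲`-clause
holds at level `log 6 − 2 = ν_cyl + δ`. LANDED as `Theorems.helper_schwarzschildBlowupExistence_sphereFour` (p135257, composing the nine landed witness
helpers p134137 p134220 p134173 p134378 p134301 p134214 p134190 p134610 p135050). [folklore] -/
theorem helper_schwarzschildBlowupExistence_sphereFour :
    ∃ g : PseudoRiemannianMetric (𝓡 4) ∞ (EuclideanSpace ℝ (Fin 4)) (TangentSpace (𝓡 4) :
      Metric.sphere (0 : EuclideanSpace ℝ (Fin 5)) 1 → Type _), ∃ _ : g.HasLeviCivita, ∃ hg :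
      g.IsRiemannian, ∃ p : Metric.sphere (0 : EuclideanSpace ℝ (Fin 5)) 1, ∃ G : Metric.sphere (0 :
      EuclideanSpace ℝ (Fin 5)) 1 → ℝ, ∃ a b r : ℝ, (ContMDiffOn (𝓡 4) 𝓘(ℝ, ℝ) ∞ G {p}ᶜ ∧ (∀ x, x ≠
      p → 0 < G x) ∧ (∀ x, x ≠ p → g.scalarCurvature x * G x - 6 * g.dalembertian G x = 0) ∧ Tendsto
      G (𝓝[≠] p) atTop) ∧ (∀ x, 0 ≤ g.scalarCurvature x) ∧ (∀ x, g.scalarCurvature x = 0 → x ∈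
      (extChartAt (𝓡 4) p).source ∧ extChartAt (𝓡 4) p x ∈ Metric.closedBall (extChartAt (𝓡 4) p p)
      r) ∧ 0 < a ∧ 0 ≤ b ∧ 0 < r ∧ (Metric.closedBall (extChartAt (𝓡 4) p p) r ⊆ (extChartAt (𝓡 4)
      p).target ∧ ∀ y ∈ Metric.closedBall (extChartAt (𝓡 4) p p) r, ∀ X W : EuclideanSpace ℝ (Fin
      4), g.val ((extChartAt (𝓡 4) p).symm y) (mfderiv 𝓘(ℝ, EuclideanSpace ℝ (Fin 4)) (𝓡 4)
      (extChartAt (𝓡 4) p).symm y X) (mfderiv 𝓘(ℝ, EuclideanSpace ℝ (Fin 4)) (𝓡 4) (extChartAt (𝓡 4)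
      p).symm y W) = ⟪X, W⟫) ∧ (∀ y ∈ Metric.closedBall (extChartAt (𝓡 4) p p) r, y ≠ extChartAt (𝓡
      4) p p → G ((extChartAt (𝓡 4) p).symm y) = a / ‖y - extChartAt (𝓡 4) p p‖ ^ 2 + b) ∧ ∃ δ : ℝ,
      0 < δ ∧ ∀ τ : ℝ, 0 < τ → ∀ w : Metric.sphere (0 : EuclideanSpace ℝ (Fin 5)) 1 → ℝ, ContMDiff
      (𝓡 4) 𝓘(ℝ, ℝ) ∞ w → w =ᶠ[𝓝 p] 0 → ∫ x, (4 * Real.pi * τ) ^ (-(4 : ℝ) / 2) * (w x) ^ 2 * (G x)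
      ^ 4 ∂(riemannianMeasure (g.toContMDiffRiemannianMetric hg)) = 1 → Real.log 2 + Real.log
      Real.pi / 2 - 3 / 2 + δ ≤ ∫ x, (4 * τ * ((G x)⁻¹ ^ 2 * g.gradSq w x) - (w x) ^ 2 * Real.log
      ((w x) ^ 2) - 4 * (w x) ^ 2) * ((4 * Real.pi * τ) ^ (-(4 : ℝ) / 2) * (G x) ^ 4)
      ∂(riemannianMeasure (g.toContMDiffRiemannianMetric hg)) :=
  _root_.Summit.SmoothPoincare4.SmoothPoincare4.Theorems.helper_schwarzschildBlowupExistence_sphereFour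

/-- **Negative export (registered): the transfer stub Â_b is SPC4-hard given the rung** — an exotic
4-sphere refutes `stub_schwarzschildBlowupExistence` as soon as `SubcylindricalRecognition` holds
(`closes` after the landed reduction `subcylindricalExistence_of_schwarzschildBlowupExistence`). LANDED as
`Negative.not_schwarzschildBlowupExistence_of_not_spc4` (p135162, `Theorems/SubcylindricalExistence/Negative/SchwarzschildBlowupExistence.lean`).
[folklore] -/
theorem not_schwarzschildBlowupExistence_of_not_spc4 :
    Summit.SmoothPoincare4.SmoothPoincare4.Theses.EntropyRung.SubcylindricalRecognition → ¬
      _root_.SmoothPoincare4 → ¬ (∀ (M : Type) [TopologicalSpace M] [T2Space M]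
      [SecondCountableTopology M] [ChartedSpace (EuclideanSpace ℝ (Fin 4)) M] [IsManifold (𝓡 4) ∞ M]
      [CompactSpace M] [T3Space M] [MeasurableSpace M] [BorelSpace M], M ≃ₕ Metric.sphere (0 :
      EuclideanSpace ℝ (Fin 5)) 1 → ∃ g : PseudoRiemannianMetric (𝓡 4) ∞ (EuclideanSpace ℝ (Fin 4))
      (TangentSpace (𝓡 4) : M → Type _), ∃ _ : g.HasLeviCivita, ∃ hg : g.IsRiemannian, ∃ p : M, ∃ G
      : M → ℝ, ∃ a b r : ℝ, (ContMDiffOn (𝓡 4) 𝓘(ℝ, ℝ) ∞ G {p}ᶜ ∧ (∀ x, x ≠ p → 0 < G x) ∧ (∀ x, x ≠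
      p → g.scalarCurvature x * G x - 6 * g.dalembertian G x = 0) ∧ Tendsto G (𝓝[≠] p) atTop) ∧ (∀
      x, 0 ≤ g.scalarCurvature x) ∧ (∀ x, g.scalarCurvature x = 0 → x ∈ (extChartAt (𝓡 4) p).source
      ∧ extChartAt (𝓡 4) p x ∈ Metric.closedBall (extChartAt (𝓡 4) p p) r) ∧ 0 < a ∧ 0 ≤ b ∧ 0 < r ∧
      (Metric.closedBall (extChartAt (𝓡 4) p p) r ⊆ (extChartAt (𝓡 4) p).target ∧ ∀ y ∈
      Metric.closedBall (extChartAt (𝓡 4) p p) r, ∀ X W : EuclideanSpace ℝ (Fin 4), g.val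
      ((extChartAt (𝓡 4) p).symm y) (mfderiv 𝓘(ℝ, EuclideanSpace ℝ (Fin 4)) (𝓡 4) (extChartAt (𝓡 4)
      p).symm y X) (mfderiv 𝓘(ℝ, EuclideanSpace ℝ (Fin 4)) (𝓡 4) (extChartAt (𝓡 4) p).symm y W) =
      ⟪X, W⟫) ∧ (∀ y ∈ Metric.closedBall (extChartAt (𝓡 4) p p) r, y ≠ extChartAt (𝓡 4) p p → G
      ((extChartAt (𝓡 4) p).symm y) = a / ‖y - extChartAt (𝓡 4) p p‖ ^ 2 + b) ∧ ∃ δ : ℝ, 0 < δ ∧ ∀ τ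
      : ℝ, 0 < τ → ∀ w : M → ℝ, ContMDiff (𝓡 4) 𝓘(ℝ, ℝ) ∞ w → w =ᶠ[𝓝 p] 0 → ∫ x, (4 * Real.pi * τ) ^
      (-(4 : ℝ) / 2) * (w x) ^ 2 * (G x) ^ 4 ∂(riemannianMeasure (g.toContMDiffRiemannianMetric hg))
      = 1 → Real.log 2 + Real.log Real.pi / 2 - 3 / 2 + δ ≤ ∫ x, (4 * τ * ((G x)⁻¹ ^ 2 * g.gradSq w
      x) - (w x) ^ 2 * Real.log ((w x) ^ 2) - 4 * (w x) ^ 2) * ((4 * Real.pi * τ) ^ (-(4 : ℝ) / 2) *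
      (G x) ^ 4) ∂(riemannianMeasure (g.toContMDiffRiemannianMetric hg))) :=
  _root_.Summit.SmoothPoincare4.Cruxes.SubcylindricalExistence.Negative.not_schwarzschildBlowupExistence_of_not_spc4

/-- **The composition (sorry-free): crux ⇐ Â_b.** `EntropyRung.SubcylindricalExistence` from the transfer
stub `stub_schwarzschildBlowupExistence` by the landed reduction
`Theorems.subcylindricalExistence_of_schwarzschildBlowupExistence` (p127092). [folklore] -/
theorem SubcylindricalExistence_of : SubcylindricalExistence :=
  _root_.Summit.SmoothPoincare4.SmoothPoincare4.Theorems.subcylindricalExistence_of_schwarzschildBlowupExistence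
    stub_schwarzschildBlowupExistence

/-- The `S⁴` instance of the crux's conclusion along THIS line's data (sanity: the witness feeds the
reduction's hypothesis shape at `M = S⁴`). [folklore] -/
example : ∃ g : PseudoRiemannianMetric (𝓡 4) ∞ (EuclideanSpace ℝ (Fin 4))
    (TangentSpace (𝓡 4) : Metric.sphere (0 : EuclideanSpace ℝ (Fin 5)) 1 → Type _),
    ∃ _ : g.HasLeviCivita, ∃ _ : g.IsRiemannian, ∃ p : Metric.sphere (0 : EuclideanSpace ℝ (Fin 5)) 1,
    ∃ G : Metric.sphere (0 : EuclideanSpace ℝ (Fin 5)) 1 → ℝ, ∃ a b r : ℝ, 0 < a ∧ 0 ≤ b ∧ 0 < r ∧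
      ContMDiffOn (𝓡 4) 𝓘(ℝ, ℝ) ∞ G {p}ᶜ ∧ ∀ x, 0 ≤ g.scalarCurvature x := by
  obtain ⟨g, hLC, hg0, p, G, a, b, r, ⟨hGs, -, -, -⟩, hR0, -, ha, hb, hr, -⟩ :=
    helper_schwarzschildBlowupExistence_sphereFour
  exact ⟨g, hLC, hg0, p, G, a, b, r, ha, hb, hr, hGs, hR0⟩

end Summit.SmoothPoincare4.SmoothPoincare4.Cruxes.SubcylindricalExistence.GreenBlowupConformalEntropy

end
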